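import Literature.MathematicalPhysics.QuantumFieldTheory.Balaban1983to89.B9Thm31SiteCoerciveReg335Y
import Literature.MathematicalPhysics.QuantumFieldTheory.Balaban1983to89.B9Thm311ProjectionR
import Literature.MathematicalPhysics.QuantumFieldTheory.Balaban1983to89.B9Ineq349SiteAdjoint

/-!
# `Balaban1983to89.B9Thm311QuantAtLettersY` — [Balaban1985BackgroundPropagators] THEOREM 3.11 p. 416 AT def-Y's TORUS LETTERS, QUANTITATIVE
# FORM ON THE REGULAR CLASS (3.35), and the letter `H′ = G′²Q′*(Q′G′²Q′*)⁻¹` of [Balaban1985RegularSpaces] (1.91) with its algebra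

statement-level skeleton of published theorems with citation tags; proofs where landed; nothing here is a claim about the
Yang–Mills mass gap

T. Bałaban, *Propagators for lattice gauge theories in a background field*, Commun. Math. Phys. **99** (1985) 389–434
[`Balaban1985BackgroundPropagators`, "[B9]"; PDF held `paper:balaban1985-cmp99-background-propagators`, journal page = PDF page + 388];
T. Bałaban, *Spaces of regular gauge field configurations on a lattice and gauge fixing conditions*, Commun. Math. Phys. **99** (1985) 75–102
[`Balaban1985RegularSpaces`, "[B8]"; PDF held `paper:balaban1985-cmp99-regular-spaces-gauge-fixing`, journal page = PDF page + 74].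

THE PRINT (verbatim, text layer re-read by this seat 2026-08-28).  [B9] p. 416: *«Theorem 3.11. Under the assumptions of the Theorems 3.1–3.10
(i.e. for M sufficiently large and α₀ sufficiently small) the operators Δ′_a, G′, (Q′G′²Q′\*)⁻¹, Δ_a, G are positive definite.  This is obvious
for the first three operators, and also for P and R, hence it is enough to prove it for G. … By (3.106) G = G₀(I − R)⁻¹ …»*; p. 394:
*«R = R(U) is an orthogonal projection in the Hilbert space L²(Ω₀, 𝔤) onto the subspace R = Δ^η_U N(Q′), N(Q′) = {λ : Q′λ = 0}. (3.21)»*,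
p. 395: *«Rf = (I − G′Q′\*(Q′G′²Q′\*)⁻¹Q′G′)f, (3.25) where G′ = G′(U) = (Δ′_a)⁻¹»*; [B8] p. 91: *«Let us introduce the operators
H′ = G′²Q′\*(Q′G′²Q′\*)⁻¹, G′ = (Δ + Q′\*aQ′)⁻¹. (1.91)  They were investigated in [4], and the following inequality can be obtained from the
results of this paper: |H′X|, (Lʲη)|∇^η_{U₀}H′X|, (Lʲη)²|Δ^η_{U₀}H′X| ≦ B′₀|X| for x ∈ Ω_j (1.92)»*.

CITATION HEADER (lean-in-tree rule).  Cell `lit-balaban` (HOME `run/shared/lean/pub/lit-balaban/`), sub-row G-B9-LETTERS («[B9] Thms 3.1–3.3 on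
T_η for the trivial domain sequence, constants d, L only»), module **M5.3** of the map of record `lit-balaban-r06/B9-LETTERS-MAP.md` v1.1 (lead g29
ALLOCATIONS #2, 2026-08-28T01:07Z (3) → seat `lit-balaban-p33` gen 91); statement list `lit-balaban-p33/M53-STATEMENTS.md` v1 §1, FILE 1.
WHAT WAS ALREADY IN THE TREE (consumed BY NAME, nothing restated): at def-Y's v4 letters (`Node00.deltaPrimeAY i (parSymY i) U`, fibre
`M_N(ℂ)`, `G ≤ U(N)`-valued `U`) Theorem 3.11's «first three operators» are positive definite for EVERY unitary background
(`B9Thm311DeltaPrimePos.deltaPrimeAY_parSymY_posDefTr ∕ GpY_parSymY_posDefTr`, `B9Thm311PosAtRecordV4.XinvY_parSymY_posDefTr ∕ thm311_firstThree_parSymY`),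
`Δ′_a(U)` is coercive on the class (3.35) with the member-free constant `(1∕8)·L^{−2k}` (`B9Thm31SiteCoerciveReg335Y.trIP_deltaPrimeAY_parSymY_ge`,
pub-ymgap n06-w1), `R(U)` of (3.25) is a symmetric idempotent with `Q′G′R = 0` (`B9Thm311ProjectionR`), and all these letters are gauge
covariant (`Node00.OpsYGauge`).

WHAT THIS FILE ADDS (sorry-free; every input BY NAME; ONE new definition with body — the letter `H′` of (1.91) — and theorems).
* §1 (generic, weighted trace pairing `trIP w`): the Cauchy–Schwarz inequality `trIP w Φ Ψ ≤ √(trIP w Φ Φ)·√(trIP w Ψ Ψ)` read off the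
  orthonormal coordinates `realify311` (`B9Thm311ReadingCoords.inner_realify311`), and ★ `inverse_bounds_of_coercive`: a coercive operator
  `T` (`c·⟨Φ,Φ⟩ ≤ ⟨Φ,TΦ⟩`) with a right inverse `S` has `c·⟨SΦ,SΦ⟩ ≤ ⟨SΦ,Φ⟩`, `⟨SΦ,SΦ⟩ ≤ c⁻²⟨Φ,Φ⟩`, `⟨SΦ,Φ⟩ ≤ c⁻¹⟨Φ,Φ⟩` — the
  operator-norm content of «positive definite» for the inverse.
* §2 ★★ THEOREM 3.11 QUANTITATIVE FOR `G′(U)` ON (3.35): for `c·M·α₀·(d+1) ≤ 1∕16` and `U ∈ (bg9K (M_N ℂ) G i).Reg335 c α₀`,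
  `(1∕8)L^{−2k}·⟨G′Φ, G′Φ⟩ ≤ ⟨G′Φ, Φ⟩` (`trIP_GpY_parSymY_self_le`), `⟨G′Φ, G′Φ⟩ ≤ (8L^{2k})²·⟨Φ,Φ⟩` (`trIP_GpY_parSymY_sq_le` — the
  member-uniform bound `‖G′(U)‖ ≤ 8L^{2k}` in lattice units announced in w1's header, now a theorem), `⟨Φ, G′Φ⟩ ≤ 8L^{2k}·⟨Φ,Φ⟩`.
* §3 ★ THE LETTER `H′(U) := G′²Q′*(Q′G′²Q′*)⁻¹` ([B8] (1.91)) at def-Y's letters (`HpY`, generic in the transporter and in `G′`), with its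
  algebra at the v4 transporter for every `G`-valued `U`: `Q′H′ = 1` (`QpY_comp_HpY_parSymY`), `G′R = (1 − H′Q′)G′` (`GpY_comp_RY_parSymY` —
  the change of variables `λ ↦ λ − H′(…)` of [B8] p. 92 read as an operator identity), `(1 − H′Q′)² = 1 − H′Q′`, `Q′(1 − H′Q′) = 0`, and the
  gauge covariance `H′(U^u)R(u) = R(u)H′(U)` (`HpY_cov`, by `Node00.OpsYGauge`'s intertwining calculus).
* §4 ★ (3.21) AT THE LETTERS: `range R(U) = Δ′_a(U)(ker Q′(U))` (`range_RY_parSymY`) — print's «R = Δ^η_U N(Q′)» with `Δ′_a` for `Δ^η_U`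
  (the two agree on `N(Q′)` by (3.24); that reading is not re-proved here), and `R(U)` fixes exactly this subspace.
* §5 the PACKAGE `thm311_quant_atLettersY` conjoining §2–§4 with the landed first-three ∕ projection ∕ covariance theorems under ONE hypothesis
  block — the shape the sub-row's later modules (M5.5 ∕ M5.6 ∕ M5.9 of the map) cite.

HONEST SCOPE.  (i) Carrier = def-Y's box chart `SiteY i` of the V1 k-level torus member `i : KIdx d ℓ …` (finite), fibre `M_N(ℂ)` with the
L2-operator norm structure, `G ≤ U(N)`; NOT the n05 knit's `ℤᵈ` carrier of `B8Thm2TorusLetters.LettersAt` ∕ `B8SockLettersRD` — the junction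
between the two carriers (and between def-Y's averaging transporter and the knit's `QprimeIter ∕ QT`) is the located joint J-CARRIER of
`lit-balaban-p33/M53-STATEMENTS.md` §2, NOT addressed here.  (ii) `Δ_a(U) > 0` on (3.35) (Theorem 3.11's fourth and fifth operators) is print's
random-walk argument (3.106)–(3.107) and is NOT claimed here (the tree has its reduction: `B9Thm311Whole.posDef_of_factor_small`,
`B9Thm311PosAtRecordV4.inputs311Y₄_of_posDefTr_deltaAY`).  (iii) (1.92)'s three estimate lines for `H′` are Theorems 3.1–3.2's content (map
modules M5.5–M5.6), not proved here.  (iv) Nothing continuum, nothing about OS axioms or the mass gap; count-neutral for every node and stub.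
No `sorry`, no `axiom`, no `instance`, no `notation`.  Seat `lit-balaban-p33` gen 91 (literature-prover), 2026-08-28.
-/

noncomputable section

namespace Literature.MathematicalPhysics.QuantumFieldTheory.Balaban1983to89.B9Thm311QuantAtLettersY

open Literature.MathematicalPhysics.QuantumFieldTheory.Balaban1983to89
open Node00 B6KLevelCensusIndexV1 B9BackgroundsKLevelV1 B9Thm311ReadingCoords B9Thm311ReadingAtLetters B9Thm311DeltaPrimePos
  B9Thm311PosAtRecordV4 B9Thm311ProjectionR B9Thm31SiteCoerciveReg335Y B9Ineq349SiteAdjoint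
open scoped Matrix Matrix.Norms.L2Operator

/-! ## §1 Cauchy–Schwarz for the weighted trace pairing; inverse bounds from coercivity -/

section Generic

variable {S n : Type} [Fintype S] [Fintype n] {w : S → ℝ} (hw : ∀ s, 0 < w s)

include hw in
/-- **Cauchy–Schwarz for print's weighted trace pairing** `⟨Φ,Ψ⟩_w = Σ_s w(s)·Re tr(Φ(s)\*Ψ(s))`: `⟨Φ,Ψ⟩_w ≤ √⟨Φ,Φ⟩_w·√⟨Ψ,Ψ⟩_w`, read off
the orthonormal coordinates `realify311`. [cite: Balaban1985BackgroundPropagators, p.393 (scalar products); folklore] -/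
theorem trIP_le_sqrt_mul_sqrt (Φ Ψ : S → Matrix n n ℂ) :
    trIP w Φ Ψ ≤ Real.sqrt (trIP w Φ Φ) * Real.sqrt (trIP w Ψ Ψ) := by
  have hΦ : ‖realify311 w hw Φ‖ = Real.sqrt (trIP w Φ Φ) := by
    rw [← norm_sq_realify311 (w := w) (hw := hw) Φ, Real.sqrt_sq (norm_nonneg _)]
  have hΨ : ‖realify311 w hw Ψ‖ = Real.sqrt (trIP w Ψ Ψ) := by
    rw [← norm_sq_realify311 (w := w) (hw := hw) Ψ, Real.sqrt_sq (norm_nonneg _)]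
  rw [← inner_realify311 (w := w) (hw := hw) Φ Ψ, ← hΦ, ← hΨ]
  exact real_inner_le_norm _ _

include hw in
/-- the weighted trace norm is nonnegative: `0 ≤ ⟨Φ,Φ⟩_w`. [cite: Balaban1985BackgroundPropagators, p.393 (scalar products); folklore] -/
theorem trIP_self_nonneg' (Φ : S → Matrix n n ℂ) : 0 ≤ trIP w Φ Φ := by
  rw [← norm_sq_realify311 (w := w) (hw := hw) Φ]
  positivity

include hw in
/-- ★ **INVERSE BOUNDS FROM COERCIVITY** (the operator-norm content of Theorem 3.11 for an inverse): if `c·⟨Φ,Φ⟩ ≤ ⟨Φ,TΦ⟩` for all `Φ` with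
`0 < c`, and `T(SΦ) = Φ` for all `Φ`, then `c·⟨SΦ,SΦ⟩ ≤ ⟨SΦ,Φ⟩`, `⟨SΦ,SΦ⟩ ≤ (c⁻¹)²·⟨Φ,Φ⟩` (i.e. `‖S‖ ≤ c⁻¹`) and `⟨SΦ,Φ⟩ ≤ c⁻¹·⟨Φ,Φ⟩`.
[cite: Balaban1985BackgroundPropagators, Thm 3.11 p.416, p.395 («positivity of the operators G′, Q′G′²Q′\*»); folklore] -/
theorem inverse_bounds_of_coercive {T Ti : (S → Matrix n n ℂ) →ₗ[ℂ] (S → Matrix n n ℂ)} {c : ℝ} (hc : 0 < c)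
    (hcoer : ∀ Φ, c * trIP w Φ Φ ≤ trIP w Φ (T Φ)) (hTS : ∀ Φ, T (Ti Φ) = Φ) (Φ : S → Matrix n n ℂ) :
    c * trIP w (Ti Φ) (Ti Φ) ≤ trIP w (Ti Φ) Φ ∧ trIP w (Ti Φ) (Ti Φ) ≤ (c⁻¹) ^ 2 * trIP w Φ Φ ∧
      trIP w (Ti Φ) Φ ≤ c⁻¹ * trIP w Φ Φ := by
  have h1 : c * trIP w (Ti Φ) (Ti Φ) ≤ trIP w (Ti Φ) Φ := by simpa only [hTS] using hcoer (Ti Φ)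
  have ha : 0 ≤ trIP w (Ti Φ) (Ti Φ) := trIP_self_nonneg' hw _
  have hb : 0 ≤ trIP w Φ Φ := trIP_self_nonneg' hw _
  have hcs := trIP_le_sqrt_mul_sqrt hw (Ti Φ) Φ
  set a := trIP w (Ti Φ) (Ti Φ) with ha_def
  set b := trIP w Φ Φ with hb_def
  set p := trIP w (Ti Φ) Φ with hp_def
  have hsa : Real.sqrt a * Real.sqrt a = a := Real.mul_self_sqrt ha
  have hsb : Real.sqrt b * Real.sqrt b = b := Real.mul_self_sqrt hb
  have hsa0 : 0 ≤ Real.sqrt a := Real.sqrt_nonneg _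
  have hsb0 : 0 ≤ Real.sqrt b := Real.sqrt_nonneg _
  -- `c √a ≤ √b`
  have hroot : c * Real.sqrt a ≤ Real.sqrt b := by
    by_cases hza : Real.sqrt a = 0
    · rw [hza, mul_zero]; exact hsb0
    have hpos : 0 < Real.sqrt a := lt_of_le_of_ne hsa0 (Ne.symm hza)
    have h2 : c * a ≤ Real.sqrt a * Real.sqrt b := h1.trans hcs
    have h3 : (c * Real.sqrt a) * Real.sqrt a ≤ Real.sqrt b * Real.sqrt a := by
      calc (c * Real.sqrt a) * Real.sqrt a = c * a := by rw [mul_assoc, hsa]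
        _ ≤ Real.sqrt a * Real.sqrt b := h2
        _ = Real.sqrt b * Real.sqrt a := mul_comm _ _
    exact le_of_mul_le_mul_right h3 hpos
  have hci : 0 ≤ c⁻¹ := inv_nonneg.mpr hc.le
  have hroot' : Real.sqrt a ≤ c⁻¹ * Real.sqrt b := by
    have h := mul_le_mul_of_nonneg_left hroot hci
    rwa [← mul_assoc, inv_mul_cancel₀ hc.ne', one_mul] at h
  have h2 : a ≤ (c⁻¹) ^ 2 * b := by
    calc a = Real.sqrt a * Real.sqrt a := hsa.symm
      _ ≤ (c⁻¹ * Real.sqrt b) * (c⁻¹ * Real.sqrt b) := mul_le_mul hroot' hroot' hsa0 (mul_nonneg hci hsb0)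
      _ = (c⁻¹) ^ 2 * (Real.sqrt b * Real.sqrt b) := by ring
      _ = (c⁻¹) ^ 2 * b := by rw [hsb]
  have h3 : p ≤ c⁻¹ * b := by
    calc p ≤ Real.sqrt a * Real.sqrt b := hcs
      _ ≤ (c⁻¹ * Real.sqrt b) * Real.sqrt b := mul_le_mul_of_nonneg_right hroot' hsb0
      _ = c⁻¹ * b := by rw [mul_assoc, hsb]
  exact ⟨h1, h2, h3⟩

end Generic

/-! ## §2 Theorem 3.11 quantitative for `G′(U) = Δ′_a(U)⁻¹` on the regular class (3.35) -/

section GpBounds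

variable {d ℓ : ℕ} {hd : 1 ≤ d + 1} {hL : Odd (ℓ + 1) ∧ 1 < ℓ + 1} {b₀ b₁ : ℝ} {N : ℕ}
variable (i : KIdx d ℓ hd hL b₀ b₁) {G : Subgroup (Matrix (Fin N) (Fin N) ℂ)ˣ}

/-- `Δ′_a(U)(G′(U)Φ) = Φ` at every `G`-valued configuration (`G ≤ U(N)`): the right-inverse law, pointwise form.
[cite: Balaban1985BackgroundPropagators, p.395 («G′ = G′(U) = (Δ′_a)⁻¹»), Thm 3.11 p.416] -/
theorem deltaPrimeAY_GpY_parSymY_apply (hG : G ≤ B7Prop2Explicit.unitaryUnits (Matrix (Fin N) (Fin N) ℂ))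
    {U : CfgY (Matrix (Fin N) (Fin N) ℂ) i} (hU : ∀ μ x, U μ x ∈ G) (Φ : SiteY i → Matrix (Fin N) (Fin N) ℂ) :
    deltaPrimeAY i (parSymY i) U (GpY i (parSymY i) U Φ) = Φ := by
  have h := deltaPrimeAY_mul_GpY i (parSymY i) U (isUnit_deltaPrimeAY_parSymY i hG hU)
  have h' := congrArg (fun T : Module.End ℂ (SiteY i → Matrix (Fin N) (Fin N) ℂ) => T Φ) h
  simpa only [Module.End.mul_apply, Module.End.one_apply] using h'

/-- `G′(U)(Δ′_a(U)Φ) = Φ` at every `G`-valued configuration (`G ≤ U(N)`): the left-inverse law, pointwise form (finite volume).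
[cite: Balaban1985BackgroundPropagators, p.395 («G′ = G′(U) = (Δ′_a)⁻¹»), Thm 3.11 p.416] -/
theorem GpY_deltaPrimeAY_parSymY_apply (hG : G ≤ B7Prop2Explicit.unitaryUnits (Matrix (Fin N) (Fin N) ℂ))
    {U : CfgY (Matrix (Fin N) (Fin N) ℂ) i} (hU : ∀ μ x, U μ x ∈ G) (Φ : SiteY i → Matrix (Fin N) (Fin N) ℂ) :
    GpY i (parSymY i) U (deltaPrimeAY i (parSymY i) U Φ) = Φ := by
  have h := GpY_mul_deltaPrimeAY i (parSymY i) U (isUnit_deltaPrimeAY_parSymY i hG hU)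
  have h' := congrArg (fun T : Module.End ℂ (SiteY i → Matrix (Fin N) (Fin N) ℂ) => T Φ) h
  simpa only [Module.End.mul_apply, Module.End.one_apply] using h'

/-- ★★ **THEOREM 3.11 QUANTITATIVE FOR `G′(U)` ON (3.35)** — for `c·M·α₀·(d+1) ≤ 1∕16` and `U` in def-Y's class `Reg335 c α₀`
(`G ≤ U(N)`-valued): with `κ = (1∕8)·L^{−2k}`, (a) `κ·⟨G′Φ, G′Φ⟩ ≤ ⟨G′Φ, Φ⟩`, (b) `⟨G′Φ, G′Φ⟩ ≤ (κ⁻¹)²·⟨Φ,Φ⟩` — the member-uniform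
operator bound `‖G′(U)‖ ≤ 8L^{2k}` in lattice units —, (c) `⟨G′Φ, Φ⟩ ≤ κ⁻¹·⟨Φ,Φ⟩`; all from w1's coercivity of `Δ′_a(U)` and §1.
[cite: Balaban1985BackgroundPropagators, Thm 3.11 p.416, Thm 3.1 p.397 (the class (3.35) and «Mα₀ ≤ a₀»), (3.24)–(3.25) pp.394–395] -/
theorem GpY_parSymY_bounds [Nonempty (Fin N)] (hG : G ≤ B7Prop2Explicit.unitaryUnits (Matrix (Fin N) (Fin N) ℂ))
    {U : CfgY (Matrix (Fin N) (Fin N) ℂ) i} (hU : ∀ μ x, U μ x ∈ G) {c α₀ : ℝ} (hC0 : 0 ≤ c * (kGeo i).M * α₀)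
    (hC1 : c * (kGeo i).M * α₀ * ((d : ℝ) + 1) ≤ 1 / 16) (hreg : (bg9K (Matrix (Fin N) (Fin N) ℂ) G i).Reg335 c α₀ U)
    (Φ : SiteY i → Matrix (Fin N) (Fin N) ℂ) :
    (1 / 8 : ℝ) * (((((ℓ + 1) ^ i.k : ℕ) : ℝ)) ^ 2)⁻¹ * trIP (fun _ => (1 : ℝ)) (GpY i (parSymY i) U Φ) (GpY i (parSymY i) U Φ)
        ≤ trIP (fun _ => (1 : ℝ)) (GpY i (parSymY i) U Φ) Φ ∧
      trIP (fun _ => (1 : ℝ)) (GpY i (parSymY i) U Φ) (GpY i (parSymY i) U Φ)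
        ≤ (((1 / 8 : ℝ) * (((((ℓ + 1) ^ i.k : ℕ) : ℝ)) ^ 2)⁻¹)⁻¹) ^ 2 * trIP (fun _ => (1 : ℝ)) Φ Φ ∧
      trIP (fun _ => (1 : ℝ)) (GpY i (parSymY i) U Φ) Φ
        ≤ ((1 / 8 : ℝ) * (((((ℓ + 1) ^ i.k : ℕ) : ℝ)) ^ 2)⁻¹)⁻¹ * trIP (fun _ => (1 : ℝ)) Φ Φ := by
  have hpow : (0 : ℝ) < ((((ℓ + 1) ^ i.k : ℕ) : ℝ)) := by positivity
  have hκ : (0 : ℝ) < (1 / 8 : ℝ) * (((((ℓ + 1) ^ i.k : ℕ) : ℝ)) ^ 2)⁻¹ := by positivity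
  exact inverse_bounds_of_coercive (w := fun _ => (1 : ℝ)) (fun _ => one_pos) hκ
    (fun Ψ => trIP_deltaPrimeAY_parSymY_ge i hG hC0 hC1 hreg Ψ) (fun Ψ => deltaPrimeAY_GpY_parSymY_apply i hG hU Ψ) Φ

/-- the constant of `GpY_parSymY_bounds` (b) in closed form: `(κ⁻¹)² = 64·L^{4k}`. [cite: Balaban1985BackgroundPropagators, Thm 3.11 p.416, bookkeeping] -/
theorem inv_kappa_sq_eq :
    (((1 / 8 : ℝ) * (((((ℓ + 1) ^ i.k : ℕ) : ℝ)) ^ 2)⁻¹)⁻¹) ^ 2 = 64 * ((((ℓ + 1) ^ i.k : ℕ) : ℝ)) ^ 4 := by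
  have hpow : (0 : ℝ) < ((((ℓ + 1) ^ i.k : ℕ) : ℝ)) := by positivity
  rw [mul_inv, inv_inv]
  ring

/-- ★★ **`‖G′(U)‖ ≤ 8L^{2k}` ON (3.35), member-uniformly** (trace-norm form): `⟨G′Φ, G′Φ⟩ ≤ 64·L^{4k}·⟨Φ,Φ⟩`.
[cite: Balaban1985BackgroundPropagators, Thm 3.11 p.416, Thm 3.1 p.397] -/
theorem trIP_GpY_parSymY_sq_le [Nonempty (Fin N)] (hG : G ≤ B7Prop2Explicit.unitaryUnits (Matrix (Fin N) (Fin N) ℂ))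
    {U : CfgY (Matrix (Fin N) (Fin N) ℂ) i} (hU : ∀ μ x, U μ x ∈ G) {c α₀ : ℝ} (hC0 : 0 ≤ c * (kGeo i).M * α₀)
    (hC1 : c * (kGeo i).M * α₀ * ((d : ℝ) + 1) ≤ 1 / 16) (hreg : (bg9K (Matrix (Fin N) (Fin N) ℂ) G i).Reg335 c α₀ U)
    (Φ : SiteY i → Matrix (Fin N) (Fin N) ℂ) :
    trIP (fun _ => (1 : ℝ)) (GpY i (parSymY i) U Φ) (GpY i (parSymY i) U Φ)
      ≤ 64 * ((((ℓ + 1) ^ i.k : ℕ) : ℝ)) ^ 4 * trIP (fun _ => (1 : ℝ)) Φ Φ := by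
  rw [← inv_kappa_sq_eq i]
  exact (GpY_parSymY_bounds i hG hU hC0 hC1 hreg Φ).2.1

/-- ★ **the form of `G′(U)` is bounded ON (3.35)**: `⟨Φ, G′Φ⟩ ≤ 8L^{2k}·⟨Φ,Φ⟩` (with the lower bound `(1∕8)L^{−2k}·⟨G′Φ,G′Φ⟩ ≤ ⟨Φ,G′Φ⟩`).
[cite: Balaban1985BackgroundPropagators, Thm 3.11 p.416, Thm 3.1 p.397] -/
theorem trIP_GpY_parSymY_self_le [Nonempty (Fin N)] (hG : G ≤ B7Prop2Explicit.unitaryUnits (Matrix (Fin N) (Fin N) ℂ))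
    {U : CfgY (Matrix (Fin N) (Fin N) ℂ) i} (hU : ∀ μ x, U μ x ∈ G) {c α₀ : ℝ} (hC0 : 0 ≤ c * (kGeo i).M * α₀)
    (hC1 : c * (kGeo i).M * α₀ * ((d : ℝ) + 1) ≤ 1 / 16) (hreg : (bg9K (Matrix (Fin N) (Fin N) ℂ) G i).Reg335 c α₀ U)
    (Φ : SiteY i → Matrix (Fin N) (Fin N) ℂ) :
    (1 / 8 : ℝ) * (((((ℓ + 1) ^ i.k : ℕ) : ℝ)) ^ 2)⁻¹ * trIP (fun _ => (1 : ℝ)) (GpY i (parSymY i) U Φ) (GpY i (parSymY i) U Φ)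
        ≤ trIP (fun _ => (1 : ℝ)) Φ (GpY i (parSymY i) U Φ) ∧
      trIP (fun _ => (1 : ℝ)) Φ (GpY i (parSymY i) U Φ) ≤ 8 * ((((ℓ + 1) ^ i.k : ℕ) : ℝ)) ^ 2 * trIP (fun _ => (1 : ℝ)) Φ Φ := by
  have h := GpY_parSymY_bounds i hG hU hC0 hC1 hreg Φ
  have hpow : (0 : ℝ) < ((((ℓ + 1) ^ i.k : ℕ) : ℝ)) := by positivity
  have hinv : ((1 / 8 : ℝ) * (((((ℓ + 1) ^ i.k : ℕ) : ℝ)) ^ 2)⁻¹)⁻¹ = 8 * ((((ℓ + 1) ^ i.k : ℕ) : ℝ)) ^ 2 := by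
    rw [mul_inv, inv_inv]; norm_num
  rw [trIP_comm _ Φ, ← hinv]
  exact ⟨h.1, h.2.2⟩

end GpBounds

/-! ## §3 The letter `H′ = G′²Q′*(Q′G′²Q′*)⁻¹` of [B8] (1.91) and its algebra -/

section HPrime

variable {d ℓ : ℕ} {hd : 1 ≤ d + 1} {hL : Odd (ℓ + 1) ∧ 1 < ℓ + 1} {b₀ b₁ : ℝ}
variable {𝔸 : Type} [NormedRing 𝔸] [NormedAlgebra ℂ 𝔸] [CompleteSpace 𝔸]
variable (i : KIdx d ℓ hd hL b₀ b₁)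

/-- ★ **THE LETTER `H′(U) = G′(U)²Q′\*(U)(Q′G′²Q′\*)⁻¹(U)` OF [B8] (1.91)** at def-Y's letters (generic site transporter `parS` and site letter
`Gp`; blocks → sites): the right inverse of the block averaging `Q′(U)` through which [B8] Sect. D changes variables `λ ↦ λ − H′D′(u₁, λ)`.
[cite: Balaban1985RegularSpaces, (1.91) p.91; Balaban1985BackgroundPropagators, (3.25) p.395] -/
def HpY (parS : SiteParY 𝔸 i) (Gp : SiteOpY 𝔸 i) (U : CfgY 𝔸 i) : (BlkY i → 𝔸) →ₗ[ℂ] (SiteY i → 𝔸) :=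
  Gp U ∘ₗ Gp U ∘ₗ QpsY i parS U ∘ₗ XinvY i parS Gp U

/-- `H′` unfolded. [cite: Balaban1985RegularSpaces, (1.91) p.91] -/
theorem HpY_apply (parS : SiteParY 𝔸 i) (Gp : SiteOpY 𝔸 i) (U : CfgY 𝔸 i) (X : BlkY i → 𝔸) :
    HpY i parS Gp U X = Gp U (Gp U (QpsY i parS U (XinvY i parS Gp U X))) := rfl

/-- `Q′H′ = (Q′G′²Q′\*)(Q′G′²Q′\*)⁻¹` as a composition — definitional bookkeeping. [cite: Balaban1985RegularSpaces, (1.91) p.91; Balaban1985BackgroundPropagators, (3.25) p.395] -/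
theorem QpY_comp_HpY (parS : SiteParY 𝔸 i) (Gp : SiteOpY 𝔸 i) (U : CfgY 𝔸 i) :
    QpY i parS U ∘ₗ HpY i parS Gp U = XY i parS Gp U ∘ₗ XinvY i parS Gp U := by
  simp only [HpY, XY, LinearMap.comp_assoc]

/-- `G′R = G′ − H′Q′G′` as a composition, for R of (3.25) — definitional bookkeeping (any transporter, any `G′`).
[cite: Balaban1985BackgroundPropagators, (3.25) p.395; Balaban1985RegularSpaces, (1.91) p.91] -/
theorem Gp_comp_RY (parS : SiteParY 𝔸 i) (Gp : SiteOpY 𝔸 i) (U : CfgY 𝔸 i) :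
    Gp U ∘ₗ RY i parS Gp U = Gp U - HpY i parS Gp U ∘ₗ QpY i parS U ∘ₗ Gp U := by
  simp only [RY, HpY, LinearMap.comp_sub, LinearMap.comp_id, LinearMap.comp_assoc]

variable (g : GaugeY 𝔸 i) (U : CfgY 𝔸 i) {parS : SiteParY 𝔸 i} {Gp : SiteOpY 𝔸 i}

variable {i g U} in
/-- ★ **`H′` IS GAUGE COVARIANT**: `H′(U^u)R(u) = R(u)H′(U)` (blocks transported at their corners, sites at themselves) — from the covariance
of `G′`, `Q′\*`, `(Q′G′²Q′\*)⁻¹` by the intertwining calculus. [cite: Balaban1985BackgroundPropagators, (3.32)–(3.33) pp.395–396; Balaban1985RegularSpaces, (1.91) p.91] -/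
theorem HpY_cov (hS : IsGaugeLawS i parS) (hGp : IsCovSiteOpY i Gp) :
    Intw (conjY (gBlkY i g)) (conjY (gSiteY i g)) (HpY i parS Gp U) (HpY i parS Gp (gaugeY i g U)) :=
  (hGp g U).comp ((hGp g U).comp ((QpsY_cov g U hS).comp (XinvY_cov hS hGp)))

end HPrime

section HPrimeV4

variable {d ℓ : ℕ} {hd : 1 ≤ d + 1} {hL : Odd (ℓ + 1) ∧ 1 < ℓ + 1} {b₀ b₁ : ℝ} {N : ℕ}
variable (i : KIdx d ℓ hd hL b₀ b₁) {G : Subgroup (Matrix (Fin N) (Fin N) ℂ)ˣ}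

/-- ★★ **`Q′(U)H′(U) = 1` AT EVERY `G`-VALUED CONFIGURATION** (`G ≤ U(N)`; def-Y's v4 transporter and genuine `G′(U)`): `H′` is a right
inverse of the block averaging — the law (1.91) is used for ([B8] p. 92: the change of variables «transforms the function Q′(u₁, λ) into Q′λ»).
[cite: Balaban1985RegularSpaces, (1.91) p.91; Balaban1985BackgroundPropagators, (3.25) p.395, Thm 3.11 p.416] -/
theorem QpY_comp_HpY_parSymY (hG : G ≤ B7Prop2Explicit.unitaryUnits (Matrix (Fin N) (Fin N) ℂ))
    {U : CfgY (Matrix (Fin N) (Fin N) ℂ) i} (hU : ∀ μ x, U μ x ∈ G) :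
    QpY i (parSymY i) U ∘ₗ HpY i (parSymY i) (GpY i (parSymY i)) U = LinearMap.id := by
  rw [QpY_comp_HpY, XY_comp_XinvY_parSymY i hG hU]

/-- `Q′(H′X) = X`, pointwise form. [cite: Balaban1985RegularSpaces, (1.91) p.91] -/
theorem QpY_HpY_parSymY (hG : G ≤ B7Prop2Explicit.unitaryUnits (Matrix (Fin N) (Fin N) ℂ))
    {U : CfgY (Matrix (Fin N) (Fin N) ℂ) i} (hU : ∀ μ x, U μ x ∈ G) (X : BlkY i → Matrix (Fin N) (Fin N) ℂ) :
    QpY i (parSymY i) U (HpY i (parSymY i) (GpY i (parSymY i)) U X) = X := by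
  have h := congrArg (fun T : (BlkY i → Matrix (Fin N) (Fin N) ℂ) →ₗ[ℂ] (BlkY i → Matrix (Fin N) (Fin N) ℂ) => T X)
    (QpY_comp_HpY_parSymY i hG hU)
  simpa only [LinearMap.comp_apply, LinearMap.id_apply] using h

/-- ★ **`G′R = (1 − H′Q′)G′`** at every `G`-valued configuration: on the range of `G′` the projection `R` of (3.25) acts as the
complementary projection `1 − H′Q′` of the right inverse `H′`. [cite: Balaban1985BackgroundPropagators, (3.25) p.395; Balaban1985RegularSpaces, (1.91)–(1.93) pp.91–92] -/
theorem GpY_comp_RY_parSymY {U : CfgY (Matrix (Fin N) (Fin N) ℂ) i} :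
    GpY i (parSymY i) U ∘ₗ RY i (parSymY i) (GpY i (parSymY i)) U =
      (LinearMap.id - HpY i (parSymY i) (GpY i (parSymY i)) U ∘ₗ QpY i (parSymY i) U) ∘ₗ GpY i (parSymY i) U := by
  rw [Gp_comp_RY, LinearMap.sub_comp, LinearMap.id_comp, LinearMap.comp_assoc]

/-- ★ **`1 − H′Q′` IS AN IDEMPOTENT** (the projection onto `ker Q′` along `range H′`) at every `G`-valued configuration.
[cite: Balaban1985RegularSpaces, (1.91) p.91; Balaban1985BackgroundPropagators, (3.20)–(3.21) p.394] -/
theorem one_sub_HpY_QpY_parSymY_idem (hG : G ≤ B7Prop2Explicit.unitaryUnits (Matrix (Fin N) (Fin N) ℂ))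
    {U : CfgY (Matrix (Fin N) (Fin N) ℂ) i} (hU : ∀ μ x, U μ x ∈ G) :
    (LinearMap.id - HpY i (parSymY i) (GpY i (parSymY i)) U ∘ₗ QpY i (parSymY i) U) ∘ₗ
        (LinearMap.id - HpY i (parSymY i) (GpY i (parSymY i)) U ∘ₗ QpY i (parSymY i) U) =
      LinearMap.id - HpY i (parSymY i) (GpY i (parSymY i)) U ∘ₗ QpY i (parSymY i) U := by
  set H := HpY i (parSymY i) (GpY i (parSymY i)) U
  set Q := QpY i (parSymY i) U
  have hQH : Q ∘ₗ H = LinearMap.id := QpY_comp_HpY_parSymY i hG hU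
  have hkey : (H ∘ₗ Q) ∘ₗ (H ∘ₗ Q) = H ∘ₗ Q := by
    rw [LinearMap.comp_assoc, ← LinearMap.comp_assoc Q H Q, hQH, LinearMap.id_comp]
  rw [LinearMap.sub_comp, LinearMap.id_comp, LinearMap.comp_sub, LinearMap.comp_id, hkey, sub_self, sub_zero]

/-- ★ **`Q′(1 − H′Q′) = 0`**: the idempotent `1 − H′Q′` maps into `ker Q′`. [cite: Balaban1985RegularSpaces, (1.91) p.91; Balaban1985BackgroundPropagators, (3.21) p.394] -/
theorem QpY_comp_one_sub_HpY_QpY_parSymY (hG : G ≤ B7Prop2Explicit.unitaryUnits (Matrix (Fin N) (Fin N) ℂ))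
    {U : CfgY (Matrix (Fin N) (Fin N) ℂ) i} (hU : ∀ μ x, U μ x ∈ G) :
    QpY i (parSymY i) U ∘ₗ (LinearMap.id - HpY i (parSymY i) (GpY i (parSymY i)) U ∘ₗ QpY i (parSymY i) U) = 0 := by
  rw [LinearMap.comp_sub, LinearMap.comp_id, ← LinearMap.comp_assoc, QpY_comp_HpY_parSymY i hG hU, LinearMap.id_comp, sub_self]

/-- `H′` at the v4 letters is gauge covariant (instance of `HpY_cov`). [cite: Balaban1985BackgroundPropagators, (3.33) p.396; Balaban1985RegularSpaces, (1.91) p.91] -/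
theorem HpY_parSymY_cov (g : GaugeY (Matrix (Fin N) (Fin N) ℂ) i) (U : CfgY (Matrix (Fin N) (Fin N) ℂ) i) :
    Intw (conjY (gBlkY i g)) (conjY (gSiteY i g)) (HpY i (parSymY i) (GpY i (parSymY i)) U)
      (HpY i (parSymY i) (GpY i (parSymY i)) (gaugeY i g U)) :=
  HpY_cov (parSymY_isGaugeLawS i) (GpY_isCovSiteOpY (parSymY_isGaugeLawS i))

end HPrimeV4

/-! ## §4 (3.21) at the letters: the range of `R(U)` -/

section RangeR

variable {d ℓ : ℕ} {hd : 1 ≤ d + 1} {hL : Odd (ℓ + 1) ∧ 1 < ℓ + 1} {b₀ b₁ : ℝ} {N : ℕ}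
variable (i : KIdx d ℓ hd hL b₀ b₁) {G : Subgroup (Matrix (Fin N) (Fin N) ℂ)ˣ}

/-- `R(U)f = Δ′_a(U)(G′f − H′Q′G′f)`: every value of the projection is `Δ′_a` of a function in `ker Q′`.
[cite: Balaban1985BackgroundPropagators, (3.21)–(3.22) p.394, (3.25) p.395] -/
theorem RY_parSymY_apply_eq (hG : G ≤ B7Prop2Explicit.unitaryUnits (Matrix (Fin N) (Fin N) ℂ))
    {U : CfgY (Matrix (Fin N) (Fin N) ℂ) i} (hU : ∀ μ x, U μ x ∈ G) (f : SiteY i → Matrix (Fin N) (Fin N) ℂ) :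
    RY i (parSymY i) (GpY i (parSymY i)) U f =
      deltaPrimeAY i (parSymY i) U
        (GpY i (parSymY i) U f - HpY i (parSymY i) (GpY i (parSymY i)) U (QpY i (parSymY i) U (GpY i (parSymY i) U f))) := by
  -- `Δ′ (G′ R f) = R f` and `G′ R f = G′ f − H′ Q′ G′ f`
  have h1 : GpY i (parSymY i) U (RY i (parSymY i) (GpY i (parSymY i)) U f) =
      GpY i (parSymY i) U f - HpY i (parSymY i) (GpY i (parSymY i)) U (QpY i (parSymY i) U (GpY i (parSymY i) U f)) := by
    have h := congrArg (fun T : (SiteY i → Matrix (Fin N) (Fin N) ℂ) →ₗ[ℂ] (SiteY i → Matrix (Fin N) (Fin N) ℂ) => T f)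
      (Gp_comp_RY i (parSymY i) (GpY i (parSymY i)) U)
    simpa only [LinearMap.comp_apply, LinearMap.sub_apply] using h
  rw [← h1, deltaPrimeAY_GpY_parSymY_apply i hG hU]

/-- `Q′(G′f − H′Q′G′f) = 0`: the preimage of `R(U)f` under `Δ′_a(U)` lies in `ker Q′`. [cite: Balaban1985BackgroundPropagators, (3.21) p.394; Balaban1985RegularSpaces, (1.91) p.91] -/
theorem QpY_GpY_sub_HpY_parSymY (hG : G ≤ B7Prop2Explicit.unitaryUnits (Matrix (Fin N) (Fin N) ℂ))
    {U : CfgY (Matrix (Fin N) (Fin N) ℂ) i} (hU : ∀ μ x, U μ x ∈ G) (f : SiteY i → Matrix (Fin N) (Fin N) ℂ) :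
    QpY i (parSymY i) U
        (GpY i (parSymY i) U f - HpY i (parSymY i) (GpY i (parSymY i)) U (QpY i (parSymY i) U (GpY i (parSymY i) U f))) = 0 := by
  rw [map_sub, QpY_HpY_parSymY i hG hU, sub_self]

/-- `R(U)` FIXES `Δ′_a(U)(ker Q′(U))` pointwise: `R(Δ′_a l) = Δ′_a l` for `Q′l = 0`. [cite: Balaban1985BackgroundPropagators, (3.21)–(3.22) p.394] -/
theorem RY_parSymY_apply_of_mem (hG : G ≤ B7Prop2Explicit.unitaryUnits (Matrix (Fin N) (Fin N) ℂ))
    {U : CfgY (Matrix (Fin N) (Fin N) ℂ) i} (hU : ∀ μ x, U μ x ∈ G) {l : SiteY i → Matrix (Fin N) (Fin N) ℂ}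
    (hl : QpY i (parSymY i) U l = 0) :
    RY i (parSymY i) (GpY i (parSymY i)) U (deltaPrimeAY i (parSymY i) U l) = deltaPrimeAY i (parSymY i) U l := by
  have h := GpY_deltaPrimeAY_parSymY_apply i hG hU l
  unfold RY
  rw [LinearMap.sub_apply, LinearMap.id_apply, LinearMap.comp_apply, LinearMap.comp_apply, LinearMap.comp_apply,
    LinearMap.comp_apply, h, hl, map_zero, map_zero, map_zero, sub_zero]

/-- ★★ **(3.21) AT def-Y's LETTERS: `range R(U) = Δ′_a(U)(ker Q′(U))`** at every `G`-valued configuration (`G ≤ U(N)`) — print's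
«R = Δ^η_U N(Q′)» (on `N(Q′)` the averaging term of (3.24) vanishes, so `Δ′_a = Δ^η_U` there; this file keeps `Δ′_a`).
[cite: Balaban1985BackgroundPropagators, (3.21) p.394, (3.24)–(3.25) pp.394–395] -/
theorem range_RY_parSymY (hG : G ≤ B7Prop2Explicit.unitaryUnits (Matrix (Fin N) (Fin N) ℂ))
    {U : CfgY (Matrix (Fin N) (Fin N) ℂ) i} (hU : ∀ μ x, U μ x ∈ G) :
    LinearMap.range (RY i (parSymY i) (GpY i (parSymY i)) U) =
      (LinearMap.ker (QpY i (parSymY i) U)).map (deltaPrimeAY i (parSymY i) U) := by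
  apply le_antisymm
  · intro ω hω
    obtain ⟨f, hf⟩ := LinearMap.mem_range.mp hω
    refine Submodule.mem_map.mpr
      ⟨GpY i (parSymY i) U f - HpY i (parSymY i) (GpY i (parSymY i)) U (QpY i (parSymY i) U (GpY i (parSymY i) U f)),
        LinearMap.mem_ker.mpr (QpY_GpY_sub_HpY_parSymY i hG hU f), ?_⟩
    rw [← RY_parSymY_apply_eq i hG hU f, hf]
  · intro ω hω
    obtain ⟨l, hl, hlω⟩ := Submodule.mem_map.mp hω
    rw [LinearMap.mem_ker] at hl
    exact LinearMap.mem_range.mpr ⟨deltaPrimeAY i (parSymY i) U l, by rw [RY_parSymY_apply_of_mem i hG hU hl, hlω]⟩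

end RangeR

/-! ## §5 The package -/

section Package

variable {d ℓ : ℕ} {hd : 1 ≤ d + 1} {hL : Odd (ℓ + 1) ∧ 1 < ℓ + 1} {b₀ b₁ : ℝ} {N : ℕ}
variable (i : KIdx d ℓ hd hL b₀ b₁) {G : Subgroup (Matrix (Fin N) (Fin N) ℂ)ˣ}

/-- ★★★ **THEOREM 3.11 AT def-Y's TORUS LETTERS, QUANTITATIVE PACKAGE ON (3.35)** — for `G ≤ U(N)`, a `G`-valued `U` in the class
`Reg335 c α₀` with `c·M·α₀·(d+1) ≤ 1∕16`: (1) `Δ′_a(U)` is coercive, `(1∕8)L^{−2k}⟨Φ,Φ⟩ ≤ ⟨Φ, Δ′_aΦ⟩` (w1); (2) `G′(U)` is its two-sided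
inverse; (3) `⟨G′Φ,G′Φ⟩ ≤ 64L^{4k}⟨Φ,Φ⟩` and `⟨Φ,G′Φ⟩ ≤ 8L^{2k}⟨Φ,Φ⟩`; (4) `Δ′_a`, `G′`, `(Q′G′²Q′\*)⁻¹` positive definite (n06-j);
(5) `R(U)` idempotent and symmetric with `Q′G′R = 0` and `range R = Δ′_a(ker Q′)`; (6) `Q′H′ = 1` and `G′R = (1 − H′Q′)G′` for `H′` of
[B8] (1.91).  The object layer the map's M5.5 ∕ M5.6 ∕ M5.9 cite; Theorem 3.11's `Δ_a`, `G` clauses are NOT included (print proves them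
through (3.106)–(3.107)). [cite: Balaban1985BackgroundPropagators, Thm 3.11 p.416, (3.21) p.394, (3.24)–(3.25) pp.394–395, Thm 3.1 p.397; Balaban1985RegularSpaces, (1.91) p.91] -/
theorem thm311_quant_atLettersY [Nonempty (Fin N)] (hG : G ≤ B7Prop2Explicit.unitaryUnits (Matrix (Fin N) (Fin N) ℂ))
    {U : CfgY (Matrix (Fin N) (Fin N) ℂ) i} (hU : ∀ μ x, U μ x ∈ G) {c α₀ : ℝ} (hC0 : 0 ≤ c * (kGeo i).M * α₀)
    (hC1 : c * (kGeo i).M * α₀ * ((d : ℝ) + 1) ≤ 1 / 16) (hreg : (bg9K (Matrix (Fin N) (Fin N) ℂ) G i).Reg335 c α₀ U) :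
    (∀ Φ, (1 / 8 : ℝ) * (((((ℓ + 1) ^ i.k : ℕ) : ℝ)) ^ 2)⁻¹ * trIP (fun _ => (1 : ℝ)) Φ Φ
        ≤ trIP (fun _ => (1 : ℝ)) Φ (deltaPrimeAY i (parSymY i) U Φ)) ∧
    (∀ Φ, deltaPrimeAY i (parSymY i) U (GpY i (parSymY i) U Φ) = Φ) ∧
    (∀ Φ, GpY i (parSymY i) U (deltaPrimeAY i (parSymY i) U Φ) = Φ) ∧
    (∀ Φ, trIP (fun _ => (1 : ℝ)) (GpY i (parSymY i) U Φ) (GpY i (parSymY i) U Φ)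
        ≤ 64 * ((((ℓ + 1) ^ i.k : ℕ) : ℝ)) ^ 4 * trIP (fun _ => (1 : ℝ)) Φ Φ) ∧
    (∀ Φ, trIP (fun _ => (1 : ℝ)) Φ (GpY i (parSymY i) U Φ) ≤ 8 * ((((ℓ + 1) ^ i.k : ℕ) : ℝ)) ^ 2 * trIP (fun _ => (1 : ℝ)) Φ Φ) ∧
    PosDefTr (fun _ => (1 : ℝ)) (deltaPrimeAY i (parSymY i) U) ∧ PosDefTr (fun _ => (1 : ℝ)) (GpY i (parSymY i) U) ∧
    PosDefTr (wB i) (XinvY i (parSymY i) (GpY i (parSymY i)) U) ∧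
    (RY i (parSymY i) (GpY i (parSymY i)) U ∘ₗ RY i (parSymY i) (GpY i (parSymY i)) U = RY i (parSymY i) (GpY i (parSymY i)) U) ∧
    IsSymmTr (fun _ => (1 : ℝ)) (RY i (parSymY i) (GpY i (parSymY i)) U) ∧
    (QpY i (parSymY i) U ∘ₗ GpY i (parSymY i) U ∘ₗ RY i (parSymY i) (GpY i (parSymY i)) U = 0) ∧
    LinearMap.range (RY i (parSymY i) (GpY i (parSymY i)) U) =
      (LinearMap.ker (QpY i (parSymY i) U)).map (deltaPrimeAY i (parSymY i) U) ∧
    (QpY i (parSymY i) U ∘ₗ HpY i (parSymY i) (GpY i (parSymY i)) U = LinearMap.id) ∧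
    (GpY i (parSymY i) U ∘ₗ RY i (parSymY i) (GpY i (parSymY i)) U =
      (LinearMap.id - HpY i (parSymY i) (GpY i (parSymY i)) U ∘ₗ QpY i (parSymY i) U) ∘ₗ GpY i (parSymY i) U) := by
  obtain ⟨hp1, hp2, hp3⟩ := thm311_firstThree_parSymY i hG hU
  refine ⟨fun Φ => trIP_deltaPrimeAY_parSymY_ge i hG hC0 hC1 hreg Φ, fun Φ => deltaPrimeAY_GpY_parSymY_apply i hG hU Φ,
    fun Φ => GpY_deltaPrimeAY_parSymY_apply i hG hU Φ, fun Φ => trIP_GpY_parSymY_sq_le i hG hU hC0 hC1 hreg Φ,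
    fun Φ => (trIP_GpY_parSymY_self_le i hG hU hC0 hC1 hreg Φ).2, hp1, hp2, hp3,
    RY_parSymY_idempotent i hG hU, RY_parSymY_isSymmTr i hG hU, QpY_GpY_RY_parSymY i hG hU, range_RY_parSymY i hG hU,
    QpY_comp_HpY_parSymY i hG hU, GpY_comp_RY_parSymY i⟩

end Package

end Literature.MathematicalPhysics.QuantumFieldTheory.Balaban1983to89.B9Thm311QuantAtLettersY

end
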